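import Literature.NumberTheory.Automorphic.ReductiveDualRootDatum
import Literature.NumberTheory.Automorphic.RootDataGLn
import HarnessLib

/-!
# The root datum of `GL n`: lang.S13 (b) proved for `(GL n, 𝔻ₙ)` (Springer 7.4.7 (1))
(trunk T-AUTOMORPHIC, G25 AutomorphicL)

Companion to `ReductiveDualRootDatum.lean` (the assembly of the named fact
`Literature.NumberTheory.Automorphic.exists_isRootDatumOf` — lang.S13 (b): a connected reductive group with a maximal torus
over an algebraically closed field has a reduced root datum, Springer 7.4.3 — from
`exists_sl2Realization` and `roots_isReduced`) and to `RootDataGLn.lean` (Springer 7.4.7 (1) (a):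
the characters `α_{ij} = t_i t_j⁻¹` of the diagonal torus `𝔻ₙ` are roots of `GL n`, realised by
the transvections `u_{ij}`). Here lang.S13 (b) is **proved outright for `G = GL n` (the subgroup
`⊤ ≤ GL n k`) and `T = 𝔻ₙ`**, by the direct computation of Springer 7.4.7 (1) (c) (*"the root
datum `Ψ(GL n, T)` is isomorphic to `(ℤⁿ, {ε_i - ε_j}, ℤⁿ, {ε_i - ε_j})`"*):

* `exists_eq_glRootChar_of_mem_roots`, `roots_top_diagonalSubgroup_eq` — **the roots of
  `(GL n, 𝔻ₙ)` are exactly the `α_{ij}`, `i ≠ j`** (7.4.7 (1) (c)): the weight vector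
  `A ≠ 0`, `t A t⁻¹ = α(t) A`, of a root homomorphism (`IsRootHom.exists_weightVector` of
  `RootDataRootsFiniteProofs.lean`, i.e. its non-vanishing linear term) gives, at an entry
  `A i j ≠ 0`, `α(t) = t_i t_j⁻¹`.
* `roots_isReduced_top_diagonalSubgroup` — Springer 7.4.4 (`roots_isReduced`) for `(GL n, 𝔻ₙ)`,
  by evaluating `α_{ij} ^ a = α_{kl} ^ b` at `diag(1, …, c, …, 1)`.
* `blockMatHom hij : M₂(R) →* Mₙ(R)` (the block embedding at rows/columns `i ≠ j`),
  `det_blockMatHom` (it preserves determinants; via Mathlib's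
  `diagonal_transvection_induction_of_det_ne_zero`), `sl2BlockHom hij : SL₂ → GL n`, the coroots
  `glCoroot i j = α_{ij}^∨ : x ↦ diag(…, x (at i), …, x⁻¹ (at j), …)` (7.4.7 (1) (c):
  `R^∨ = {ε_i - ε_j}`), and `isSL2Realization_sl2BlockHom` — **the block embedding realises
  `(α_{ij}, α_{ij}^∨)`** (`IsSL2Realization`: algebraic, restricts to `u_{ij}`, `u_{ji}` on the
  unipotent subgroups, to `α_{ij}^∨` on the diagonal torus); hence
  `exists_sl2Realization_top_diagonalSubgroup` (Springer 8.1.4 (i) for `GL n`).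
* `Literature.NumberTheory.Automorphic.exists_isRootDatumOf_generalLinearGroup` — **lang.S13 (b) for `(GL n, 𝔻ₙ)`**, from
  the two previous items and `exists_isRootDatumOf_of_sl2Realization`.

All declarations are proved (no named facts). The hypotheses `IsConnectedReductive ⊤` and
`IsMaximalTorusIn 𝔻ₙ ⊤` inside `exists_isRootDatumOf` are not used by this computation (they are
consumed by the general assembly only through `roots_finite_holds` and the torus `𝔻ₙ`).

## Mathlib

`Matrix.transvection`, `Matrix.TransvectionStruct`,
`Matrix.diagonal_transvection_induction_of_det_ne_zero`, `Matrix.single`,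
`Matrix.SpecialLinearGroup.toGL`, `Units.map`.
Mathlib has no roots or root data *of algebraic groups* (the abstract `RootPairing` of `GL n` /
type `A_{n-1}` is not in Mathlib either); nothing here duplicates a Mathlib declaration (searched
`blockDiagonal` — Mathlib's `Matrix.blockDiagonal` is indexed by a product type, not by a pair of
indices of `n` —, `fromBlocks`, `transvection`).

## References

* [SpringerLAG1998] T. A. Springer, *Linear Algebraic Groups*, 2nd ed., Progress in Mathematics 9,
  Birkhäuser (1998): 7.4.3, 7.4.4, 7.4.7 (1) (a)–(c), 8.1.1 (i), 8.1.4 (i).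
* M. Demazure, A. Grothendieck, *SGA 3*, Exp. XXII 1.14.
-/

open scoped MatrixGroups

noncomputable section

namespace Literature.NumberTheory.Automorphic

variable {k : Type*} [Field k] {n : Type*} [Fintype n] [DecidableEq n]

/-! ### The roots of `(GL n, 𝔻ₙ)` are the `α_{ij}` (Springer 7.4.7 (1) (c)) -/

section RootsGLn

/-- The element `diag(d)` of `𝔻ₙ`. [folklore] -/
def diagElt (d : n → kˣ) : ↥(diagonalSubgroup n k) := ⟨diagonalGL n k d, d, rfl⟩

/-- The matrix of `diagElt d` is `diag(d)`. [folklore] -/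
@[simp] lemma coe_diagElt (d : n → kˣ) : ((diagElt d : ↥(diagonalSubgroup n k)) : GL n k) =
    diagonalGL n k d := rfl

/-- Every element of `𝔻ₙ` is a `diag(d)`. [folklore] -/
lemma exists_diagElt_eq (t : ↥(diagonalSubgroup n k)) : ∃ d : n → kˣ, diagElt d = t := by
  obtain ⟨d, hd⟩ := t.2
  exact ⟨d, Subtype.ext hd⟩

/-- `α_{ij}(diag(d)) = d_i d_j⁻¹`. [folklore] -/
lemma glRootChar_diagElt (i j : n) (d : n → kˣ) :
    ((glRootChar i j : ↥(characterLattice (diagonalSubgroup n k))) :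
      ↥(diagonalSubgroup n k) →* kˣ) (diagElt d) = d i * (d j)⁻¹ := by
  ext
  rw [coe_glRootChar_apply, coe_diagElt, coe_diagonalGL, Matrix.diagonal_apply_eq,
    Matrix.diagonal_apply_eq, Units.val_mul, Units.val_inv_eq_inv_val]

/-- **The roots of `(GL n, 𝔻ₙ)` are the characters `α_{ij}`, `i ≠ j`** (Springer 7.4.7 (1) (c):
`R = {ε_i - ε_j | i ≠ j}`; with 7.4.7 (1) (a), `glRootChar_mem_roots`, this computes
`roots (GL n) 𝔻ₙ`). Proof: a root homomorphism `u` for `α` has a non-zero weight vector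
`A ∈ Mₙ(k)` with `t A t⁻¹ = α(t) A` (`IsRootHom.exists_weightVector`, the linear term of `u`);
at an entry `A i j ≠ 0` this reads `t_i t_j⁻¹ = α(t)` for all `t ∈ 𝔻ₙ`, so `α = α_{ij}`, and
`i ≠ j` as `α ≠ 1`. [cite: SpringerLAG1998, 7.4.7 (1) (c)] -/
theorem exists_eq_glRootChar_of_mem_roots [Infinite k]
    {α : ↥(characterLattice (diagonalSubgroup n k))}
    (hα : α ∈ roots (⊤ : Subgroup (GL n k)) (diagonalSubgroup n k)) :
    ∃ i j : n, i ≠ j ∧ α = glRootChar i j := by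
  obtain ⟨hα1, hTG, u, hu⟩ := hα
  obtain ⟨A, hA0, hA⟩ := hu.exists_weightVector
  obtain ⟨i, j, hij⟩ : ∃ i j, A i j ≠ 0 := by
    by_contra! h
    exact hA0 (Matrix.ext fun i j => h i j)
  have key : ∀ d : n → kˣ,
      (α : ↥(diagonalSubgroup n k) →* kˣ) (diagElt d) = d i * (d j)⁻¹ := by
    intro d
    have h := hA (diagElt d) i j
    rw [coe_diagElt, ← Matrix.coe_units_inv, ← map_inv (diagonalGL n k) d, coe_diagonalGL,
      coe_diagonalGL, Matrix.mul_diagonal, Matrix.diagonal_mul, Pi.inv_apply] at h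
    have h' : (d i : k) * ((d j)⁻¹ : kˣ) * A i j =
        (((α : ↥(diagonalSubgroup n k) →* kˣ) (diagElt d) : kˣ) : k) * A i j := by
      rw [← h]
      ring
    have h'' := mul_right_cancel₀ hij h'
    exact Units.ext (by rw [Units.val_mul]; exact h''.symm)
  have hαeq : α = glRootChar i j := by
    apply Subtype.ext
    ext t : 1
    obtain ⟨d, rfl⟩ := exists_diagElt_eq t
    rw [key d, glRootChar_diagElt]
  refine ⟨i, j, ?_, hαeq⟩
  rintro rfl
  apply hα1
  rw [hαeq]
  ext t : 1
  obtain ⟨d, rfl⟩ := exists_diagElt_eq t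
  rw [glRootChar_diagElt, mul_inv_cancel, MonoidHom.one_apply]

/-- Hence `roots (GL n) 𝔻ₙ = {α_{ij} | i ≠ j}` over an infinite field (Springer 7.4.7 (1) (a), (c)).
[cite: SpringerLAG1998, 7.4.7 (1) (c)] -/
theorem roots_top_diagonalSubgroup_eq [Infinite k] :
    roots (⊤ : Subgroup (GL n k)) (diagonalSubgroup n k) =
      {α | ∃ i j : n, i ≠ j ∧ α = glRootChar i j} := by
  ext α
  refine ⟨exists_eq_glRootChar_of_mem_roots, ?_⟩
  rintro ⟨i, j, hij, rfl⟩
  classical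
  obtain ⟨c, hc⟩ := Infinite.exists_notMem_finset ({0, 1} : Finset k)
  simp only [Finset.mem_insert, Finset.mem_singleton, not_or] at hc
  exact glRootChar_mem_roots i j hij ⟨Units.mk0 c hc.1, fun h => hc.2 (by simpa using congrArg Units.val h)⟩

end RootsGLn

/-! ### The root system of `(GL n, 𝔻ₙ)` is reduced (Springer 7.4.4 for `GL n`) -/

section ReducedGLn

/-- `α_{kl}(diag(1, …, c, …, 1))` (`c` at position `i`) is `c`, `c⁻¹` or `1`. [folklore] -/
lemma glRootChar_diagElt_update (i a b : n) (hab : a ≠ b) (c : kˣ) :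
    ((glRootChar a b : ↥(characterLattice (diagonalSubgroup n k))) :
        ↥(diagonalSubgroup n k) →* kˣ) (diagElt (Function.update 1 i c)) =
      if a = i then c else if b = i then c⁻¹ else 1 := by
  rw [glRootChar_diagElt]
  simp only [Function.update_apply, Pi.one_apply]
  by_cases ha : a = i
  · have hb : b ≠ i := fun hb => hab (ha.trans hb.symm)
    simp [ha, hb]
  · by_cases hb : b = i
    · simp [ha, hb]
    · simp [ha, hb]

/-- **Springer 7.4.4 for `(GL n, 𝔻ₙ)`**: the named fact `roots_isReduced` holds for `GL n` and
its diagonal torus — if `α_{ij} ^ a = α_{kl} ^ b` with `a, b ≠ 0` then `a = ±b` (evaluate at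
`diag(1, …, c, …, 1)` with `c` at position `i`: `c ^ a ∈ {c ^ b, c ^ {-b}, 1}` for all `c ∈ kˣ`,
and `m ↦ (c ↦ c ^ m)` is injective over an infinite field, `zpowGroupHom_units_injective`).
[cite: SpringerLAG1998, 7.4.4 with 7.4.7 (1) (c)] -/
theorem roots_isReduced_top_diagonalSubgroup :
    roots_isReduced (G := (⊤ : Subgroup (GL n k))) (T := diagonalSubgroup n k) := by
  intro _ _ _ α β hα hβ a b ha hb hab
  obtain ⟨i, j, hij, rfl⟩ := exists_eq_glRootChar_of_mem_roots hα
  obtain ⟨i', j', hij', rfl⟩ := exists_eq_glRootChar_of_mem_roots hβ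
  -- evaluate `α_{ij} ^ a = α_{i'j'} ^ b` at `diag(1, …, c, …, 1)` (`c` at `i`)
  have hev : ∀ c : kˣ, c ^ a = (if i' = i then c else if j' = i then c⁻¹ else 1) ^ b := by
    intro c
    have h := congrArg (fun γ : ↥(characterLattice (diagonalSubgroup n k)) =>
      (γ : ↥(diagonalSubgroup n k) →* kˣ) (diagElt (Function.update 1 i c))) hab
    simp only [Subgroup.coe_zpow, MonoidHom.zpow_apply] at h
    rwa [glRootChar_diagElt_update i i j hij, glRootChar_diagElt_update i i' j' hij',
      if_pos rfl] at h
  by_cases h1 : i' = i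
  · left
    simp only [h1, if_true] at hev
    exact zpowGroupHom_units_injective (k := k) (MonoidHom.ext fun c => by simpa using hev c)
  · by_cases h2 : j' = i
    · right
      simp only [h1, h2, if_false, if_true, inv_zpow'] at hev
      exact zpowGroupHom_units_injective (k := k) (MonoidHom.ext fun c => by simpa using hev c)
    · exfalso
      simp only [h1, h2, if_false, one_zpow] at hev
      have h0 : a = 0 :=
        zpowGroupHom_units_injective (k := k) (MonoidHom.ext fun c => by simpa using hev c)
      exact ha h0

end ReducedGLn

/-! ### `SL₂`-realisations of the roots of `GL n`: the block embeddings `SL₂ → GL n` -/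

section SL2Block

variable {R : Type*} [CommRing R]

attribute [local instance] isMulCommutative_diagonalSubgroup

/-- Plant a `2 × 2` matrix `A` at rows and columns `i, j` of an `n × n` matrix (zero elsewhere):
`A₀₀ E_{ii} + A₀₁ E_{ij} + A₁₀ E_{ji} + A₁₁ E_{jj}`. [folklore] -/
def plant (i j : n) (A : Matrix (Fin 2) (Fin 2) R) : Matrix n n R :=
  Matrix.single i i (A 0 0) + Matrix.single i j (A 0 1) + Matrix.single j i (A 1 0) +
    Matrix.single j j (A 1 1)

omit [Fintype n] in
/-- `plant` is additive. [folklore] -/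
lemma plant_add (i j : n) (A B : Matrix (Fin 2) (Fin 2) R) :
    plant i j (A + B) = plant i j A + plant i j B := by
  simp only [plant, Matrix.add_apply, Matrix.single_add]
  abel

omit [Fintype n] in
/-- `plant 0 = 0`. [folklore] -/
lemma plant_zero (i j : n) : plant i j (0 : Matrix (Fin 2) (Fin 2) R) = 0 := by
  simp [plant]

/-- `plant` is multiplicative for `i ≠ j` (`E_{ab} E_{cd} = δ_{bc} E_{ad}`). [folklore] -/
lemma plant_mul {i j : n} (hij : i ≠ j) (A B : Matrix (Fin 2) (Fin 2) R) :
    plant i j A * plant i j B = plant i j (A * B) := by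
  simp only [plant, add_mul, mul_add, Matrix.single_mul_single_same,
    Matrix.single_mul_single_of_ne, ne_eq, hij, hij.symm, not_false_eq_true, add_zero, zero_add,
    Matrix.mul_apply, Fin.sum_univ_two, Matrix.single_add]
  abel

omit [Fintype n] in
/-- Entries of `plant`. [folklore] -/
lemma plant_apply (i j : n) (A : Matrix (Fin 2) (Fin 2) R) (p q : n) :
    plant i j A p q = (if i = p ∧ i = q then A 0 0 else 0) + (if i = p ∧ j = q then A 0 1 else 0) +
      (if j = p ∧ i = q then A 1 0 else 0) + (if j = p ∧ j = q then A 1 1 else 0) := by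
  simp only [plant, Matrix.add_apply, Matrix.single_apply]

/-- The **block embedding** of `2 × 2` matrices at rows/columns `i ≠ j`:
`A ↦ 1 + plant (A - 1)`, i.e. `A` in the `{i, j}`-block and the identity elsewhere; a monoid
homomorphism `M₂(R) → Mₙ(R)`. [folklore] -/
def blockMatHom {i j : n} (hij : i ≠ j) : Matrix (Fin 2) (Fin 2) R →* Matrix n n R where
  toFun A := 1 + plant i j (A - 1)
  map_one' := by rw [sub_self, plant_zero, add_zero]
  map_mul' A B := by
    have h : A * B - 1 = (A - 1) + (B - 1) + (A - 1) * (B - 1) := by noncomm_ring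
    rw [h, plant_add, plant_add, ← plant_mul hij]
    noncomm_ring

/-- Unfolding of `blockMatHom`. [folklore] -/
lemma blockMatHom_apply {i j : n} (hij : i ≠ j) (A : Matrix (Fin 2) (Fin 2) R) :
    blockMatHom hij A = 1 + plant i j (A - 1) := rfl

/-- Entries of the block embedding. [folklore] -/
lemma blockMatHom_apply_apply {i j : n} (hij : i ≠ j) (A : Matrix (Fin 2) (Fin 2) R) (p q : n) :
    blockMatHom hij A p q = (if p = q then 1 else 0) + ((if i = p ∧ i = q then A 0 0 - 1 else 0) +
      (if i = p ∧ j = q then A 0 1 else 0) + (if j = p ∧ i = q then A 1 0 else 0) +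
      (if j = p ∧ j = q then A 1 1 - 1 else 0)) := by
  rw [blockMatHom_apply, Matrix.add_apply, Matrix.one_apply, plant_apply]
  simp only [Matrix.sub_apply, Matrix.one_apply_eq, Matrix.one_apply_ne (show (0 : Fin 2) ≠ 1 by decide),
    Matrix.one_apply_ne (show (1 : Fin 2) ≠ 0 by decide), sub_zero]

/-- The block embedding commutes with ring homomorphisms applied entrywise. [folklore] -/
lemma blockMatHom_map {S : Type*} [CommRing S] {i j : n} (hij : i ≠ j) (f : R →+* S)
    (A : Matrix (Fin 2) (Fin 2) R) : (blockMatHom hij A).map f = blockMatHom hij (A.map f) := by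
  ext p q
  rw [Matrix.map_apply, blockMatHom_apply_apply, blockMatHom_apply_apply]
  simp only [Matrix.map_apply, map_add, apply_ite f, map_one, map_zero, map_sub]

/-- The block embedding of a transvection is a transvection. [folklore] -/
lemma blockMatHom_transvection_zero_one {i j : n} (hij : i ≠ j) (c : R) :
    blockMatHom hij (Matrix.transvection 0 1 c) = Matrix.transvection i j c := by
  rw [blockMatHom_apply, Matrix.transvection, Matrix.transvection, add_sub_cancel_left]
  congr 1
  simp [plant]

/-- The block embedding of a lower transvection is a transvection. [folklore] -/
lemma blockMatHom_transvection_one_zero {i j : n} (hij : i ≠ j) (c : R) :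
    blockMatHom hij (Matrix.transvection 1 0 c) = Matrix.transvection j i c := by
  rw [blockMatHom_apply, Matrix.transvection, Matrix.transvection, add_sub_cancel_left]
  congr 1
  simp [plant]

/-- The block embedding of a diagonal matrix is diagonal. [folklore] -/
lemma blockMatHom_diagonal {i j : n} (hij : i ≠ j) (D : Fin 2 → R) :
    blockMatHom hij (Matrix.diagonal D) =
      Matrix.diagonal (fun p => if p = i then D 0 else if p = j then D 1 else 1) := by
  ext p q
  rw [blockMatHom_apply_apply, Matrix.diagonal_apply_ne _ (show (0 : Fin 2) ≠ 1 by decide),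
    Matrix.diagonal_apply_ne _ (show (1 : Fin 2) ≠ 0 by decide), Matrix.diagonal_apply_eq,
    Matrix.diagonal_apply_eq]
  by_cases hpq : p = q
  · subst hpq
    rw [Matrix.diagonal_apply_eq]
    by_cases hip : i = p
    · subst hip
      have hji : ¬ (j = i) := fun h => hij h.symm
      simp [hji]
    · by_cases hjp : j = p
      · subst hjp
        have hji : ¬ (j = i) := fun h => hip h.symm
        simp [hip, hji]
      · have hpi : ¬ (p = i) := fun h => hip h.symm
        have hpj : ¬ (p = j) := fun h => hjp h.symm
        simp [hip, hjp, hpi, hpj]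
  · rw [Matrix.diagonal_apply_ne _ hpq]
    have h1 : ¬ (i = p ∧ i = q) := fun h => hpq (h.1.symm.trans h.2)
    have h2 : ¬ (j = p ∧ j = q) := fun h => hpq (h.1.symm.trans h.2)
    simp [h1, h2, hpq]

/-- **The block embedding preserves determinants** (for invertible `2 × 2` matrices over a
field): by Mathlib's `diagonal_transvection_induction_of_det_ne_zero` it suffices to treat
diagonal matrices and transvections. [folklore] -/
theorem det_blockMatHom {i j : n} (hij : i ≠ j) (A : Matrix (Fin 2) (Fin 2) k) (hA : A.det ≠ 0) :
    (blockMatHom hij A).det = A.det := by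
  refine Matrix.diagonal_transvection_induction_of_det_ne_zero
    (fun M => (blockMatHom hij M).det = M.det) A hA (fun D _ => ?_) (fun t => ?_)
    (fun A B _ _ hPA hPB => ?_)
  · rw [blockMatHom_diagonal hij, Matrix.det_diagonal, Matrix.det_diagonal, Fin.prod_univ_two,
      Finset.prod_eq_mul i j hij (fun c _ hc => by simp [hc.1, hc.2]) (fun h => absurd (Finset.mem_univ i) h)
        (fun h => absurd (Finset.mem_univ j) h)]
    simp [hij.symm]
  · obtain ⟨a, b, hab, c⟩ := t
    rw [Matrix.TransvectionStruct.toMatrix_mk, Matrix.det_transvection_of_ne _ _ hab]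
    fin_cases a <;> fin_cases b
    · exact absurd rfl hab
    · simp only [Fin.zero_eta, Fin.mk_one]
      rw [blockMatHom_transvection_zero_one hij, Matrix.det_transvection_of_ne _ _ hij]
    · simp only [Fin.zero_eta, Fin.mk_one]
      rw [blockMatHom_transvection_one_zero hij, Matrix.det_transvection_of_ne _ _ hij.symm]
    · exact absurd rfl hab
  · rw [map_mul, Matrix.det_mul, Matrix.det_mul, hPA, hPB]

/-- The block embedding `SL₂ → GL n` at rows/columns `i ≠ j` (Springer 7.4.7 (1): the subgroups
`G_{α_{ij}} ⊃ (G_{α_{ij}}, G_{α_{ij}}) ≅ SL₂` of `GL n`). [folklore] -/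
def sl2BlockGL {i j : n} (hij : i ≠ j) : SL(2, k) →* GL n k :=
  (Units.map (blockMatHom hij (R := k))).comp Matrix.SpecialLinearGroup.toGL

/-- The matrix of `sl2BlockGL hij g`. [folklore] -/
@[simp] lemma coe_sl2BlockGL {i j : n} (hij : i ≠ j) (g : SL(2, k)) :
    ((sl2BlockGL hij g : GL n k) : Matrix n n k) = blockMatHom hij (g : Matrix (Fin 2) (Fin 2) k) :=
  rfl

/-- The block embedding `SL₂ → GL n`, valued in the subgroup `⊤`. [folklore] -/
def sl2BlockHom {i j : n} (hij : i ≠ j) : SL(2, k) →* ↥(⊤ : Subgroup (GL n k)) :=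
  (sl2BlockGL hij).codRestrict ⊤ fun _ => Subgroup.mem_top _

/-- The matrix of `sl2BlockHom hij g`. [folklore] -/
@[simp] lemma coe_sl2BlockHom {i j : n} (hij : i ≠ j) (g : SL(2, k)) :
    (((sl2BlockHom hij g : ↥(⊤ : Subgroup (GL n k))) : GL n k) : Matrix n n k) =
      blockMatHom hij (g : Matrix (Fin 2) (Fin 2) k) :=
  rfl

/-- The coroot `α_{ij}^∨ : x ↦ diag(1, …, x (at i), …, x⁻¹ (at j), …, 1)` of `GL n`
(Springer 7.4.7 (1) (c): `R^∨ = {ε_i - ε_j}`), as an element of `X_*(𝔻ₙ)`. [folklore] -/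
def glCoroot (i j : n) : ↥(cocharacterLattice (diagonalSubgroup n k)) :=
  ⟨cocharOfVec (T := diagonalSubgroup n k) (Pi.single i 1 - Pi.single j 1) (fun _ => ⟨_, rfl⟩),
    isAlgebraicCochar_cocharOfVec (T := diagonalSubgroup n k) _ (fun _ => ⟨_, rfl⟩)⟩

/-- The matrix of `α_{ij}^∨(x)`. [folklore] -/
lemma coe_glCoroot_apply (i j : n) (x : kˣ) :
    ((((glCoroot i j : ↥(cocharacterLattice (diagonalSubgroup n k))) :
        kˣ →* ↥(diagonalSubgroup n k)) x : ↥(diagonalSubgroup n k)) : GL n k) =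
      diagonalGL n k (fun p => x ^ ((Pi.single i 1 - Pi.single j 1 : n → ℤ) p)) :=
  rfl

/-! ### The realisations, and lang.S13 (b) for `GL n` -/

/-- `α_{ij}⁻¹ = α_{ji}`. [folklore] -/
lemma inv_coe_glRootChar (i j : n) :
    ((glRootChar i j : ↥(characterLattice (diagonalSubgroup n k))) :
        ↥(diagonalSubgroup n k) →* kˣ)⁻¹ =
      ((glRootChar j i : ↥(characterLattice (diagonalSubgroup n k))) :
        ↥(diagonalSubgroup n k) →* kˣ) := by
  ext t : 1
  obtain ⟨d, rfl⟩ := exists_diagElt_eq t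
  rw [MonoidHom.inv_apply, glRootChar_diagElt, glRootChar_diagElt, mul_inv_rev, inv_inv]

omit [Fintype n] [DecidableEq n] in
/-- The upper unipotent matrix of `SL₂` is a transvection. [folklore] -/
lemma upperSL2_eq_transvection (x : k) :
    !![(1 : k), x; 0, 1] = Matrix.transvection 0 1 x := by
  ext a b
  fin_cases a <;> fin_cases b <;> simp [Matrix.transvection]

omit [Fintype n] [DecidableEq n] in
/-- The lower unipotent matrix of `SL₂` is a transvection. [folklore] -/
lemma lowerSL2_eq_transvection (x : k) :
    !![(1 : k), 0; x, 1] = Matrix.transvection 1 0 x := by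
  ext a b
  fin_cases a <;> fin_cases b <;> simp [Matrix.transvection]

omit [Fintype n] [DecidableEq n] in
/-- The diagonal matrix of `SL₂`. [folklore] -/
lemma diagSL2_eq_diagonal (t : kˣ) :
    !![(t : k), 0; 0, ((t⁻¹ : kˣ) : k)] = Matrix.diagonal ![(t : k), ((t⁻¹ : kˣ) : k)] := by
  ext a b
  fin_cases a <;> fin_cases b <;> simp

/-- Under the block embedding the upper unipotent subgroup of `SL₂` becomes `u_{ij}`.
[folklore] -/
lemma sl2BlockHom_comp_unipotentUpperSL2 {i j : n} (hij : i ≠ j) :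
    (sl2BlockHom (k := k) hij).comp unipotentUpperSL2 = glRootHom i j hij := by
  refine MonoidHom.ext fun x => ?_
  apply Subtype.ext
  apply Units.ext
  change blockMatHom hij ((unipotentUpperSL2 x : SL(2, k)) : Matrix (Fin 2) (Fin 2) k) =
    (((glRootHom i j hij x : ↥(⊤ : Subgroup (GL n k))) : GL n k) : Matrix n n k)
  rw [coe_unipotentUpperSL2, coe_glRootHom, upperSL2_eq_transvection,
    blockMatHom_transvection_zero_one]

/-- Under the block embedding the lower unipotent subgroup of `SL₂` becomes `u_{ji}`.
[folklore] -/
lemma sl2BlockHom_comp_unipotentLowerSL2 {i j : n} (hij : i ≠ j) :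
    (sl2BlockHom (k := k) hij).comp unipotentLowerSL2 = glRootHom j i hij.symm := by
  refine MonoidHom.ext fun x => ?_
  apply Subtype.ext
  apply Units.ext
  change blockMatHom hij ((unipotentLowerSL2 x : SL(2, k)) : Matrix (Fin 2) (Fin 2) k) =
    (((glRootHom j i hij.symm x : ↥(⊤ : Subgroup (GL n k))) : GL n k) : Matrix n n k)
  rw [coe_unipotentLowerSL2, coe_glRootHom, lowerSL2_eq_transvection,
    blockMatHom_transvection_one_zero]

/-- Under the block embedding the diagonal torus of `SL₂` becomes the coroot `α_{ij}^∨`.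
[folklore] -/
lemma sl2BlockHom_diagSL2 {i j : n} (hij : i ≠ j) (t : kˣ) :
    sl2BlockHom hij (diagSL2 t) = Subgroup.inclusion le_top
      (((glCoroot i j : ↥(cocharacterLattice (diagonalSubgroup n k))) :
        kˣ →* ↥(diagonalSubgroup n k)) t) := by
  apply Subtype.ext
  apply Units.ext
  change blockMatHom hij ((diagSL2 t : SL(2, k)) : Matrix (Fin 2) (Fin 2) k) =
    (((((glCoroot i j : ↥(cocharacterLattice (diagonalSubgroup n k))) :
        kˣ →* ↥(diagonalSubgroup n k)) t : ↥(diagonalSubgroup n k)) : GL n k) : Matrix n n k)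
  rw [coe_diagSL2, coe_glCoroot_apply, coe_diagonalGL, diagSL2_eq_diagonal, blockMatHom_diagonal hij]
  congr 1
  funext p
  simp only [Matrix.cons_val_zero, Matrix.cons_val_one, Pi.sub_apply,
    Pi.single_apply]
  by_cases hpi : p = i
  · subst hpi
    simp [hij]
  · by_cases hpj : p = j
    · subst hpj
      simp [hpi]
    · simp [hpi, hpj]

/-- **The block embedding `SL₂ → GL n` at `(i, j)` realises `(α_{ij}, α_{ij}^∨)`**
(`IsSL2Realization`): it is algebraic (polynomial entries, determinant one —
`det_blockMatHom`), its restrictions to the unipotent subgroups are the root homomorphisms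
`u_{ij}`, `u_{ji}` for `α_{ij}`, `α_{ji} = α_{ij}⁻¹` (`isRootHom_glRootHom`), and
`diag(t, t⁻¹) ↦ α_{ij}^∨(t)`. This is Springer 8.1.4 (i) for `GL n`, by direct computation
(7.4.7 (1)). [cite: SpringerLAG1998, 7.4.7 (1) (c)] -/
theorem isSL2Realization_sl2BlockHom {i j : n} (hij : i ≠ j) :
    IsSL2Realization (⊤ : Subgroup (GL n k)) (diagonalSubgroup n k) le_top
      ((glRootChar i j : ↥(characterLattice (diagonalSubgroup n k))) :
        ↥(diagonalSubgroup n k) →* kˣ)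
      ((glCoroot i j : ↥(cocharacterLattice (diagonalSubgroup n k))) :
        kˣ →* ↥(diagonalSubgroup n k)) (sl2BlockHom hij) := by
  classical
  refine ⟨?_, ?_, ?_, sl2BlockHom_diagSL2 hij⟩
  · -- polynomial coordinates
    set XM : Matrix (Fin 2) (Fin 2) (MvPolynomial (Fin 2 × Fin 2) k) :=
      Matrix.of fun a b => MvPolynomial.X (a, b) with hXM
    refine ⟨Sum.elim (fun pq : n × n => blockMatHom hij XM pq.1 pq.2) (fun _ => 1), fun g c => ?_⟩
    set e : Fin 2 × Fin 2 → k := fun ab => (g : Matrix (Fin 2) (Fin 2) k) ab.1 ab.2 with he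
    have hX : XM.map (MvPolynomial.eval e) = (g : Matrix (Fin 2) (Fin 2) k) := by
      ext a b
      simp [hXM, he]
    rcases c with ⟨p, q⟩ | u
    · have h := congrFun (congrFun (blockMatHom_map hij (MvPolynomial.eval e) XM) p) q
      rw [Matrix.map_apply, hX] at h
      rw [Sum.elim_inl, glCoordFun_inl, coe_sl2BlockHom, h]
    · rw [Sum.elim_inr, glCoordFun_inr, coe_sl2BlockHom, map_one,
        det_blockMatHom hij _ (by rw [Matrix.SpecialLinearGroup.det_coe]; exact one_ne_zero),
        Matrix.SpecialLinearGroup.det_coe, inv_one]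
  · rw [sl2BlockHom_comp_unipotentUpperSL2]
    exact isRootHom_glRootHom i j hij
  · rw [inv_coe_glRootChar, sl2BlockHom_comp_unipotentLowerSL2]
    exact isRootHom_glRootHom j i hij.symm

/-- **`exists_sl2Realization` holds for `(GL n, 𝔻ₙ)`** (Springer 8.1.4 (i) for `GL n`, via
7.4.7 (1)): every root is an `α_{ij}` (`exists_eq_glRootChar_of_mem_roots`) and is realised by
the block embedding `SL₂ → GL n` at `(i, j)`. [cite: SpringerLAG1998, 7.4.7 (1) (c)] -/
theorem exists_sl2Realization_top_diagonalSubgroup :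
    exists_sl2Realization (G := (⊤ : Subgroup (GL n k))) (T := diagonalSubgroup n k) := by
  intro _ _ hT _ α hα
  obtain ⟨i, j, hij, rfl⟩ := exists_eq_glRootChar_of_mem_roots hα
  exact ⟨glCoroot i j, sl2BlockHom hij, isSL2Realization_sl2BlockHom hij⟩

end SL2Block

end Literature.NumberTheory.Automorphic

/-! ### lang.S13 (b) for `GL n` -/

namespace Literature.NumberTheory.Automorphic


/-- **lang.S13 (b) for the general linear group** (Springer 7.4.7 (1) (c): *the root datum
`Ψ(GL n, T)` is isomorphic to `(ℤⁿ, {ε_i - ε_j}, ℤⁿ, {ε_i - ε_j})`*; SGA 3 XXII 1.14). The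
named fact `exists_isRootDatumOf` — a connected reductive group with a maximal torus over an
algebraically closed field has a reduced root datum — **holds for `GL n` and its diagonal torus
`𝔻ₙ`**: unconditionally in the structure theory, by direct computation of the roots
(`roots_top_diagonalSubgroup_eq`: the `α_{ij}`), of their `SL₂`-realisations (the block
embeddings, `exists_sl2Realization_top_diagonalSubgroup`) and of reducedness
(`roots_isReduced_top_diagonalSubgroup`), fed into the proved assembly
`exists_isRootDatumOf_of_sl2Realization` (Springer 7.4.3: dual bases of `X*(T)`, `X_*(T)`,
(RD 1), (RD 2) via the Weyl elements `n_α`, Mathlib's `RootPairing.mk'`).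
[cite: SpringerLAG1998, 7.4.7 (1) (c) with 7.4.3] -/
theorem exists_isRootDatumOf_generalLinearGroup {k : Type*} [Field k] {n : Type*} [Fintype n]
    [DecidableEq n] :
    exists_isRootDatumOf (G := (⊤ : Subgroup (GL n k))) (T := diagonalSubgroup n k) :=
  exists_isRootDatumOf_of_sl2Realization exists_sl2Realization_top_diagonalSubgroup
    roots_isReduced_top_diagonalSubgroup

end Literature.NumberTheory.Automorphic
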